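import Summits.BirchSwinnertonDyer.Rank1Residual.X4.KuriharaLowerHalf
import Summits.BirchSwinnertonDyer.Rank1Residual.Supersingular.SurjSerreCertificateShape
import Summits.BirchSwinnertonDyer.Rank1Residual.Supersingular.RankOneRem13RecordShapesCount
import Summits.BirchSwinnertonDyer.Rank1Residual.Additive.X4ThreeKuriharaCertKernel
import Summits.BirchSwinnertonDyer.Rank1Residual.X11b.KrausMinimalityGeneralTwo
import Literature.NumberTheory.EllipticCurves.ManinConstantConductorLe300000
import Summits.BirchSwinnertonDyer.Rank1Residual.Additive.GordCycLeadingTermSemistableTwist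
import Summits.BirchSwinnertonDyer.Rank1Residual.SecondDescent.X10aPrimeTargetsKernelCertificates
import Summits.BirchSwinnertonDyer.Rank1Residual.Additive.X4ThreeResCertKernel
import Summits.BirchSwinnertonDyer.Rank1Residual.Additive.N10IsogenyTransport
import HarnessLib

/-!
# Route `AdditiveBranchIMC` (rung K1, cell `bsd-addord`), crux `GordTwoRankZeroOffCaseOne`
# (item stmt-BirchSwinnertonDyer-19357), registered half-crux stub `stub_irreducible` — PER-ROW RECORDS 05:
# Kurihara-number (Kim 2026 Thm 1.8 (6)) certificates on the SURJECTIVE content rows of cell (G-ord, e = 2) at `p ≥ 5`,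
# surjectivity and the Kolyvagin level IN THE KERNEL, the Kurihara VALUE an EVIDENCE binder
# (a `--supports stmt-BirchSwinnertonDyer-19357 --as helper` file; seat `bsd-addord-k1-c2x` (lane B), gen 5)

HONEST FRAMING. Per-row instances of the crux's conclusion `MissingLowerBoundAt W p`
(L₀ = `ord_p #Ш_an ≤ ord_p #Ш`) on rows of `stub_irreducible`'s domain (`r_an = 0`, `N10.CellGordTwo`, `E[p]`
irreducible — here `ρ̄` onto); CONDITIONAL on named PUBLISHED inputs; the class-wide stub and the crux stay
OPEN; nothing is booked by this file (booking is referee A's); BSD is not proved by any of this.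

Rows in this file: `409650b1`@5 (n = 41·71), `419850k1`@5 (n = 181·211).

ROAD (the one lane A of this crux is NOT on; PUBLISHED, no reduction hypothesis at `p`): C.-H. Kim,
Amer. J. Math. 148 (2026) Thm 1.8 (6) (= arXiv:2203.12159 Thm 1.9 (6)) — in analytic rank `0` with `ρ̄_{E,p}`
onto and the Manin constant prime to `p`, ONE unit Kurihara number `δ̃_n ≢ 0 (mod p)` at a cyclic Kolyvagin
level gives `length Ш(E/ℚ)[p^∞] ≥ ord_p(L(E,1)/Ω_E)`, i.e. the LOWER half. On cell (G-ord, e = 2) (Kodaira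
I₀*, `E = V ⊗ χ_{p*}` with `V` good ordinary at `p`) the local torsion `E(ℚ_p)[p]` is trivial at `p ≥ 5`
(`E ≅ V` over `ℚ_p(√p*)`, `e = 2 < p − 1`, and Gal acts by `−1`; = Kim Prop 3.2: `a₄ ≢ 10 (25)` /
`a₆ ≢ 14 (49)` on the twisted model), so a DEPTH-ONE certificate (`ℓᵢ ≡ 1`, `a_ℓ ≡ ℓ + 1 (mod p)`) is the
printed case `t = 0` (no `K26-(6)-shallow@t>0` issue). The tree's additive Kurihara records (`X4/KimAdditiveRecords*`,
T-KIMADD) stop at `N ≤ 129 850` and cell `bsd-potss` (seats kt-kur5/5b) certified the potentially SUPERSINGULAR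
rows; the potentially ORDINARY `e = 2` rows at `N > 130 000` of this crux were in no Kurihara universe before.

RECORD SHAPE = cell `bsd-potss`'s p458600 `Theorems.tameMissingLowerBoundAt_rankZero_of_intModel_of_serre_of_pair`,
inlined exactly as in its record files `KatoDescentTamePotSupersingularTameLowerOffSeedKuriharaRecordsNN` through
`X4.missingLowerBoundAt_rankZero_of_kimLower` + `X4.periodTransfer_of_optimal` (nothing cell-specific enters):
`MissingLowerBoundAt W p` for Cremona's LITERAL minimal model, from
* IN THE KERNEL (`decide` on Cremona's coefficients): `Δ ≠ 0`; global minimality (x11c's bounded / support Kraus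
  criterion); surjectivity of `ρ̄_{E,p}` from THREE Serre Prop-19 witnesses (`Supersingular.surj_of_ainvs_of_serreWitnesses`,
  schema point counts `countPoints`); the level `n = ℓ₁ℓ₂ ∈ 𝒩₁(E,p)` — `ℓᵢ ∤ Δ`, `ℓᵢ ≡ 1 (mod p)`,
  `p ∣ #Ẽ(𝔽_{ℓᵢ})` — and the cyclicity binder `#Ẽ(𝔽_{ℓᵢ})[p] ≤ p` from `p² ∤ #Ẽ(𝔽_{ℓᵢ})` (schema point
  counts; a count at a prime `ℓ > 1000` is a DATA binder `hcount`);
* NAMED PUBLISHED INPUTS in hypothesis position: Kim 2026 Thm 1.8 (6) (`hKim`, tree fact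
  `Kim2026.rankZero_le_padicValNat_sha_of_kuriharaNumber_ne_zero`, NO reduction hypothesis at `p`), GZK (`hGZK`),
  modularity (`hmod`), Cremona's Manin-constant computation to `300000` (`h300`; rows with `N > 300000` carry
  `hc : p ∤ c_D` instead — Cremona `opt_man`: optimality code 1, `c = 1` on every row of this file);
* EVIDENCE binders per row: `r_an = 0` (`hr`; Cremona), the OPTIMAL datum at level `N` (`D`, `hopt`; Cremona's
  curve `…1`, optimality code 1), and the VALUE `hδ : ∃ ψ, δ̃_n ≢ 0 (mod p)` at the NAMED level — TWO engines of
  DIFFERENT method at the SAME level: engine 1 = kit kit j286086 (cell `bsd-potss` seat kt-kur5's `kt5_engineBf.py`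
  sha16 c8f8fa3338435b75 BYTE-IDENTICAL: numerical modular symbols at level `N` by the harvest-2 ENGINE-B formulas, exact
  rationals certified by the exact Hecke relations — 0 failures — and `[0]⁺ = #Ш_an·∏c_ℓ/#E(ℚ)²_tors` exactly);
  engine 2 = kit kit j288123 (cell `b2b-bsdres` additive-p4 GEN22 line V41 `twist41.gp` sha16 f596fb048fb0d05c BYTE-IDENTICAL:
  EXACT modular symbols of the good ordinary twist `V = E^{(p*)}` at level `N/p²` by PARI `msfromell` + Birch
  twisting `[r]⁺_E = c·Σ_u (p*/u)[r + u/p]^±_V`, `|c|_p = 1`; no numerics); per-row provenance in each docstring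
  and in the item's evidence `CERTS-k1c2x-g5.tsv`.

References: [Kim2022StructureSelmer] Thm. 1.9 (6), §1.2.2, §1.3.5, §1.4.3, Prop. 3.2 (= Amer. J. Math. 148 (2026) Thm. 1.8);
[Serre1972] §2.8 Prop. 19; [AgasheRibetStein2006] Thm. 2.6; [CesnaviciusNeururerSaha2023] §1; [Cremona1997] §2.8, Table 1;
[Pal2012] (period ratio of a quadratic twist); [SilvermanAEC2009] VII.1; [Kraus1989]; [Miller2011LMS] Def. 1.1.
-/

set_option autoImplicit false
-- precedent (`KatoDescentTamePotSupersingularTameLowerOffSeedKuriharaRecords33.lean`): the directory name repeats the summit name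
set_option linter.dupNamespace false

noncomputable section

open scoped Classical MatrixGroups ModularForm

namespace Summit.BirchSwinnertonDyer.BirchSwinnertonDyer.Theorems.AdditiveBranchIMCGordTwoRankZeroKurihara

open CongruenceSubgroup WeierstrassCurve Literature.NumberTheory.EllipticCurves
  Literature.NumberTheory.EllipticCurves.ModularForms
  Literature.NumberTheory.EllipticCurves.Rank1Residual
  Literature.NumberTheory.EllipticCurves.Rank1Residual.Typed
  Literature.NumberTheory.EllipticCurves.Rank1Residual.X11RankOneCertificates
  Summit.BirchSwinnertonDyer.Rank1Residual
  Summit.BirchSwinnertonDyer.Rank1Residual.Additive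
  Summit.BirchSwinnertonDyer.Rank1Residual.X4
  Summit.BirchSwinnertonDyer.Rank1Residual.X11b
  Summit.BirchSwinnertonDyer.Rank1Residual.Supersingular
  Summit.BirchSwinnertonDyer.BirchSwinnertonDyer.Rank1Residual.IntModel
  Summit.BirchSwinnertonDyer.BirchSwinnertonDyer.Rank1Residual.X11RankOne

-- `decide` evaluates `discOf`/`c4Of`/`c6Of`, the Kraus tests and the schema point counts on the literal coefficients
set_option maxRecDepth 100000 in
set_option maxHeartbeats 1000000 in
/-- **L₀ = `ord_5 #Ш_an ≤ ord_5 #Ш` for `409650b1`** (Cremona's minimal model `[1, 0, 1, -2188801, -1238386252]`, `N = 409650 = 5²·16386`; additive potentially GOOD ORDINARY with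
semistability defect `e = 2` at `5` (Kodaira I₀*, cell `N10.CellGordTwo`, `E = V ⊗ χ_{5}` with `V` good ordinary of conductor `16386`); `r_an = 0`, `#Ш_an = 25`, `∏ c_ℓ = 4`, `#E(ℚ)_tors = 2`;
class of 4 curve(s), `5 ∣ #Ш_an` on every member; crux 19357 content row of the A2 R823 residue; NO record of any kind for this row before (lane A: no rank-2 congruent partner in Cremona or in the Hesse-pencil waves)).
IN THE KERNEL: minimality (bounded Kraus form); `Δ ≠ 0`; `ρ̄_{E,5}` onto by Serre Prop. 19 witnesses (i) `q = 17`: `#Ẽ = 20`, `a = -2`, `a² − 4q ≡ 4²`,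
(ii) `q = 7`: `#Ẽ = 12`, `a = -4`, Euler `−1`, (iii) `q = 7`: `#Ẽ = 12`, `a = -4`, `u = 3`; the level `n = 41·71 = 2911 ∈ 𝒩₁(E,5)`:
`#Ẽ(𝔽_{41}) = 40` (kernel), `#Ẽ(𝔽_{71}) = 60` (kernel), both `≡ 0 (mod 5)`, `≢ 0 (mod 5²)`
(cyclic `5`-torsion).
EVIDENCE (value binder `hδ`): `δ̃_{2911} ≡ 2 (mod 5)` — engine 1 = Bf kit j286086 (`D = 2`, rounding deviation `1.6e-09`, exact Hecke relations `110`/0 failed,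
`[0]⁺ = 25` = BSD value); engine 2 (V41 exact twist, SAME level): kit j288123 N0=16386, δ̃_{2911} ≡ 4·c with c = 2 (|c|_5 = 1, exact from [0]), i.e. ≡ 2 (mod 5) — AGREE; V41 values {"2911": "4"}. Local torsion `E(ℚ_5)[5] = 0` (I₀* twist, `t = 0`: depth-one level is the printed case). Manin: `N > 300000`: `5 ∤ c_D` is the DISPLAYED binder `hc` (Cremona: optimal curve, `c = 1`, DATA).
CONDITIONAL on `hKim` (Kim 2026 Thm. 1.8 (6), PUBLISHED), GZK, modularity, the Manin binder `hc`; per-row instance of crux 19357's conclusion on a `stub_irreducible` row; NOT a class theorem; nothing booked.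
[cite: Kim2022StructureSelmer, Thm. 1.9 (6) (PDF p. 8), §1.2.2, §1.4.3] [cite: Serre1972, §2.8 Prop. 19] [cite: Cremona1997, Table 1 (label 409650b1), §2.8] [cite: Miller2011LMS, Def. 1.1] -/
theorem gordTwoLower_kur_v409650b1_5 (hKim : Kim2026.rankZero_le_padicValNat_sha_of_kuriharaNumber_ne_zero)
    (hGZK : rank_eq_analyticRank_of_analyticRank_le_one) (hmod : hasEntireLFunction_rat)
    (W : WeierstrassCurve ℚ) (hW : W = ⟨1, 0, 1, -2188801, -1238386252⟩)
    (hr : W.analyticRank = 0) (D : ModularParametrizationData W 409650)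
    (hopt : ∀ z ∈ D.L.lattice, ∃ w ∈ periodLattice D.f, z = D.c * w)
    (hc : ¬ ((5 : ℕ) : ℤ) ∣ D.maninConstant)
    (hδ : ∃ ψ : (ℓ : ℕ) → (ZMod ℓ)ˣ →* Multiplicative (ZMod (5 ^ 1)),
      (∀ ℓ ∈ (41 * 71 : ℕ).primeFactors, Function.Surjective (ψ ℓ)) ∧ kuriharaNumber D.f (5 ^ 1) (41 * 71) ψ ≠ 0) :
    MissingLowerBoundAt W 5 := by
  subst hW
  have hmin : (⟨1, 0, 1, -2188801, -1238386252⟩ : WeierstrassCurve ℚ).IsGloballyMinimal :=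
    isGloballyMinimal_of_krausCriterion_bounded 1 0 1 (-2188801) (-1238386252)
      (by decide +kernel) (by decide +kernel) (by decide +kernel)
  haveI := hmin
  haveI : (⟨1, 0, 1, -2188801, -1238386252⟩ : WeierstrassCurve ℚ).IsElliptic := isElliptic_of_discOf_ne_zero 1 0 1 (-2188801) (-1238386252) (by decide +kernel)
  have hI : integralModelInt (⟨1, 0, 1, -2188801, -1238386252⟩ : WeierstrassCurve ℚ) = (⟨1, 0, 1, -2188801, -1238386252⟩ : WeierstrassCurve ℤ) :=
    integralModelInt_eq_of_map_eq _ (map_mk_int 1 0 1 (-2188801) (-1238386252))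
  have hsurj : Surj (⟨1, 0, 1, -2188801, -1238386252⟩ : WeierstrassCurve ℚ) 5 :=
    @surj_of_ainvs_of_serreWitnesses 1 0 1 (-2188801) (-1238386252) 5 ⟨by norm_num⟩ (by norm_num) hmin
      17 7 7 (by norm_num) (by norm_num) (by norm_num) (by decide) (by decide) (by decide)
      (by decide) (by decide) (by decide) (by decide +kernel) (by decide +kernel) (by decide +kernel)
      (n₁ := 20) (n₂ := 12) (n₃ := 12) (by decide +kernel) (by decide +kernel) (by decide +kernel)
      (4 : ZMod 5) (3 : ZMod 5) (by decide +kernel) (by decide +kernel) (by decide +kernel)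
  -- the `Fact p.Prime` instance enters only now: the `decide` goals above must be closed terms
  haveI hp : Fact (Nat.Prime 5) := ⟨by norm_num⟩
  haveI : Fact (Nat.Prime 41) := ⟨by norm_num⟩
  haveI : Fact (Nat.Prime 71) := ⟨by norm_num⟩
  have hc₁ := natCard_point_eq_of_countPoints 1 0 1 (-2188801) (-1238386252) 41 (by norm_num) (by decide +kernel) (n := 40) (by decide +kernel)
  have hc₂ := natCard_point_eq_of_countPoints 1 0 1 (-2188801) (-1238386252) 71 (by norm_num) (by decide +kernel) (n := 60) (by decide +kernel)
  have hk₁ : Kato.IsKolyvaginPrime (⟨1, 0, 1, -2188801, -1238386252⟩ : WeierstrassCurve ℚ) 5 1 41 :=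
    isKolyvaginPrime_of_intModel_of_card hI 5 1 41 (by norm_num) (by rw [intCurve_Δ]; decide +kernel) (by decide) hc₁ (by norm_num)
  have hk₂ : Kato.IsKolyvaginPrime (⟨1, 0, 1, -2188801, -1238386252⟩ : WeierstrassCurve ℚ) 5 1 71 :=
    isKolyvaginPrime_of_intModel_of_card hI 5 1 71 (by norm_num) (by rw [intCurve_Δ]; decide +kernel) (by decide) hc₂ (by norm_num)
  haveI : NeZero (41 * 71 : ℕ) := ⟨by norm_num⟩
  obtain ⟨ψ, hψ, hδ⟩ := hδ
  exact X4.missingLowerBoundAt_rankZero_of_kimLower _ 5 hKim hGZK (by norm_num) hsurj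
    (((⟨1, 0, 1, -2188801, -1238386252⟩ : WeierstrassCurve ℚ).analyticRank_eq_zero_iff_holds (hmod _)).mp hr) D hc (periodTransfer_of_optimal 5 D hopt hc)
    1 (41 * 71) le_rfl (Nat.le_add_left 1 _) (isKolyvaginProduct_mul hk₁ hk₂ (by norm_num))
    (forall_card_torsion_le_of_pair hI 5 41 71 hc₁ hc₂ (by norm_num) (by norm_num)) ψ hψ hδ

/-- **`BSD(E,5)` for `E = 409650b1`** from the Kurihara certificate: LOWER half = `gordTwoLower_kur_v409650b1_5` (Kim 2026 Thm 1.8 (6), this file);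
UPPER half = the cell's semistable-twist door `Addv.missingUpperBoundAt_rankZero_of_semistableTwist_of_surj` (Kato 2004 Thm 17.4 (3) in Wuthrich's
half-eigenspace reading `hK`, Delbourgo 1998 Prop 4 `hDel98`, Pal 2012 `hPal`, modularity `hmod`/`hmodD`; NO Tamagawa / Manin / partner hypothesis) with,
IN THE KERNEL, `Addv W 5` (`5 ∣ Δ`, `5 ∣ c₄`), the twist model `V = [1, 1, 1, -87552, -9942111]` (`= E^{(5)}` minimal, conductor `16386`: `Δ ≠ 0`, bounded Kraus form; `#Ṽ(𝔽_5) = 4`, `a_5 = 2`: good ORDINARY at `5`) and the explicit isomorphism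
`⟨1, -2, 1/2, 1/2⟩ • V^{(5)} = W` — i.e. the row lies in cell (G-ord, e = 2) = `N10.CellGordTwo` (crux 19357's domain, stub `stub_irreducible`).
Binders = those of `gordTwoLower_kur_v409650b1_5` + `hK hDel98 hPal hmodD`. Booking-table currency shape of lane A's `bsdp_c<E>_<p>` with the certificate
binder `hδ` (Kurihara VALUE, two engines) in place of `θ` / `hSel`. Per row; NOT a class theorem; nothing booked. BSD is not proved by any of this.
[cite: Kim2022StructureSelmer, Thm. 1.9 (6) (PDF p. 8)] [cite: Kato2004Asterisque, Thm. 17.4 (3) (p. 273)] [cite: Wuthrich2014, §3 (p. 390)] [cite: Delbourgo1998, Prop. 4 (p. 144)]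
[cite: Pal2012, Thm. 3.2] [cite: Miller2011LMS, §1 and Def. 1.1] [cite: Cremona1997, Table 1 (label 409650b1)] -/
theorem gordTwoBsdp_kur_v409650b1_5 (hKim : Kim2026.rankZero_le_padicValNat_sha_of_kuriharaNumber_ne_zero)
    (hGZK : rank_eq_analyticRank_of_analyticRank_le_one) (hmod : hasEntireLFunction_rat)
    (hK : Wuthrich2014.kato_halfEigenCharIdeal_dvd_cyclotomicPrime_of_surjective)
    (hDel98 : Delbourgo1998.prop4_rankZero_pow_dvd_constantCoeff)
    (hPal : Pal2012.thm32_sqrt_mul_realPeriodRat_twist_eq_of_prime_one_mod_four)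
    (hmodD : nonempty_modularParametrizationData)
    (W : WeierstrassCurve ℚ) [W.IsElliptic] [W.IsGloballyMinimal] (hW : W = ⟨1, 0, 1, -2188801, -1238386252⟩)
    (hr : W.analyticRank = 0) (D : ModularParametrizationData W 409650)
    (hopt : ∀ z ∈ D.L.lattice, ∃ w ∈ periodLattice D.f, z = D.c * w)
    (hc : ¬ ((5 : ℕ) : ℤ) ∣ D.maninConstant)
    (hδ : ∃ ψ : (ℓ : ℕ) → (ZMod ℓ)ˣ →* Multiplicative (ZMod (5 ^ 1)),
      (∀ ℓ ∈ (41 * 71 : ℕ).primeFactors, Function.Surjective (ψ ℓ)) ∧ kuriharaNumber D.f (5 ^ 1) (41 * 71) ψ ≠ 0) :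
    BSDp W 5 := by
  have hlow : MissingLowerBoundAt W 5 :=
    gordTwoLower_kur_v409650b1_5 hKim hGZK hmod W hW hr D hopt hc hδ
  subst hW
  have hminW : (⟨1, 0, 1, -2188801, -1238386252⟩ : WeierstrassCurve ℚ).IsGloballyMinimal :=
    isGloballyMinimal_of_krausCriterion_bounded 1 0 1 (-2188801) (-1238386252)
      (by decide +kernel) (by decide +kernel) (by decide +kernel)
  have hIW : integralModelInt (⟨1, 0, 1, -2188801, -1238386252⟩ : WeierstrassCurve ℚ) = (⟨1, 0, 1, -2188801, -1238386252⟩ : WeierstrassCurve ℤ) :=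
    integralModelInt_eq_of_map_eq _ (map_mk_int 1 0 1 (-2188801) (-1238386252))
  have hsurj : Surj (⟨1, 0, 1, -2188801, -1238386252⟩ : WeierstrassCurve ℚ) 5 :=
    @surj_of_ainvs_of_serreWitnesses 1 0 1 (-2188801) (-1238386252) 5 ⟨by norm_num⟩ (by norm_num) hminW
      17 7 7 (by norm_num) (by norm_num) (by norm_num) (by decide) (by decide) (by decide)
      (by decide) (by decide) (by decide) (by decide +kernel) (by decide +kernel) (by decide +kernel)
      (n₁ := 20) (n₂ := 12) (n₃ := 12) (by decide +kernel) (by decide +kernel) (by decide +kernel)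
      (4 : ZMod 5) (3 : ZMod 5) (by decide +kernel) (by decide +kernel) (by decide +kernel)
  -- the `Fact p.Prime` instance enters only now: the `decide` goals above must be closed terms
  haveI hp : Fact (Nat.Prime 5) := ⟨by norm_num⟩
  -- the good ordinary twist model V = E^(5) (PARI ellminimalmodel(elltwist(E,5)) = Connell's formulas on (c₄/p², ±c₆/p³)): Δ ≠ 0, Kraus minimality, GoodOrd at p — all kernel
  haveI hVell : (⟨1, 1, 1, -87552, -9942111⟩ : WeierstrassCurve ℚ).IsElliptic := isElliptic_of_discOf_ne_zero 1 1 1 (-87552) (-9942111) (by decide +kernel)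
  haveI hVmin : (⟨1, 1, 1, -87552, -9942111⟩ : WeierstrassCurve ℚ).IsGloballyMinimal :=
    isGloballyMinimal_of_krausCriterion_bounded 1 1 1 (-87552) (-9942111)
    (by decide +kernel) (by decide +kernel) (by decide +kernel)
  have hVI : integralModelInt (⟨1, 1, 1, -87552, -9942111⟩ : WeierstrassCurve ℚ) = (⟨1, 1, 1, -87552, -9942111⟩ : WeierstrassCurve ℤ) :=
    integralModelInt_eq_of_map_eq _ (map_mk_int 1 1 1 (-87552) (-9942111))
  have hVc : Nat.card (((⟨1, 1, 1, -87552, -9942111⟩ : WeierstrassCurve ℤ).map (Int.castRingHom (ZMod 5))).toAffine.Point) = 4 := by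
    have h := natCard_point_eq_countPoints 1 1 1 (-87552) (-9942111) 5 (by norm_num) (by decide +kernel)
    have h' : countPoints [1, 1, 1, -87552, -9942111] 5 = 4 := by decide +kernel
    exact_mod_cast h.trans h'
  have hVgood : GoodOrd (⟨1, 1, 1, -87552, -9942111⟩ : WeierstrassCurve ℚ) 5 := SecondDescent.goodOrd_of_intModel 5 hVI (by decide +kernel) hVc (by decide)
  have hadd : Addv (⟨1, 0, 1, -2188801, -1238386252⟩ : WeierstrassCurve ℚ) 5 := Additive.addv_of_intModel hIW 5 (by decide +kernel) (by decide +kernel)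
  have hWV : (⟨1, (-2 : ℚ), ((1 : ℚ) / 2), ((1 : ℚ) / 2)⟩ : VariableChange ℚ) • (⟨1, 1, 1, -87552, -9942111⟩ : WeierstrassCurve ℚ).quadraticTwist ((-1 : ℚ) ^ (5 / 2) * 5) = (⟨1, 0, 1, -2188801, -1238386252⟩ : WeierstrassCurve ℚ) := by
    ext <;> simp [WeierstrassCurve.variableChange_a₁, WeierstrassCurve.variableChange_a₂,
      WeierstrassCurve.variableChange_a₃, WeierstrassCurve.variableChange_a₄, WeierstrassCurve.variableChange_a₆,
      WeierstrassCurve.quadraticTwist, WeierstrassCurve.b₂, WeierstrassCurve.b₄, WeierstrassCurve.b₆] <;> norm_num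
  exact bsdp_of_missingPPartAt _ 5 hGZK (by rw [hr]; norm_num)
    (missingPPartAt_of_lower_of_upper _ 5 hlow
      (Addv.missingUpperBoundAt_rankZero_of_semistableTwist_of_surj hK hDel98 hPal hGZK hmod hmodD (by norm_num)
        hadd (⟨1, 1, 1, -87552, -9942111⟩ : WeierstrassCurve ℚ) (⟨1, (-2 : ℚ), ((1 : ℚ) / 2), ((1 : ℚ) / 2)⟩ : VariableChange ℚ) hWV (Or.inl hVgood) hsurj hr))

/-- **`BSD(E',5)` for every globally minimal `E'` `ℚ`-isogenous to `E = 409650b1`** (Cremona class of 4 curve(s)): Cassels' invariance (`hCassels`,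
`N10.bsdp_of_isIsogenous_of_bsdp`) on `gordTwoBsdp_kur_v409650b1_5`. Per class; nothing booked. [cite: MilneADT2006, Thm. I.7.3 and Remark I.7.4]
[cite: Kim2022StructureSelmer, Thm. 1.9 (6) (PDF p. 8)] [cite: Kato2004Asterisque, Thm. 17.4 (3) (p. 273)] [cite: Miller2011LMS, §1 and Def. 1.1] -/
theorem isogenous_gordTwoBsdp_kur_v409650b1_5 (hCassels : bsdRHS_eq_of_isIsogenous)
    (hKim : Kim2026.rankZero_le_padicValNat_sha_of_kuriharaNumber_ne_zero)
    (hGZK : rank_eq_analyticRank_of_analyticRank_le_one) (hmod : hasEntireLFunction_rat)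
    (hK : Wuthrich2014.kato_halfEigenCharIdeal_dvd_cyclotomicPrime_of_surjective)
    (hDel98 : Delbourgo1998.prop4_rankZero_pow_dvd_constantCoeff)
    (hPal : Pal2012.thm32_sqrt_mul_realPeriodRat_twist_eq_of_prime_one_mod_four)
    (hmodD : nonempty_modularParametrizationData)
    (W : WeierstrassCurve ℚ) [W.IsElliptic] [W.IsGloballyMinimal] (hW : W = ⟨1, 0, 1, -2188801, -1238386252⟩)
    (hr : W.analyticRank = 0) (D : ModularParametrizationData W 409650)
    (hopt : ∀ z ∈ D.L.lattice, ∃ w ∈ periodLattice D.f, z = D.c * w)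
    (hc : ¬ ((5 : ℕ) : ℤ) ∣ D.maninConstant)
    (hδ : ∃ ψ : (ℓ : ℕ) → (ZMod ℓ)ˣ →* Multiplicative (ZMod (5 ^ 1)),
      (∀ ℓ ∈ (41 * 71 : ℕ).primeFactors, Function.Surjective (ψ ℓ)) ∧ kuriharaNumber D.f (5 ^ 1) (41 * 71) ψ ≠ 0)
    {W' : WeierstrassCurve ℚ} [W'.IsElliptic] [W'.IsGloballyMinimal] (hiso : IsIsogenous W' W) :
    BSDp W' 5 := by
  haveI : Fact (Nat.Prime 5) := ⟨by norm_num⟩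
  have hr' : W'.analyticRank ≤ 1 := by rw [analyticRank_eq_of_isIsogenous' hiso, hr]; exact zero_le_one
  exact N10.bsdp_of_isIsogenous_of_bsdp 5 hCassels hGZK hmod hiso hr'
    (gordTwoBsdp_kur_v409650b1_5 hKim hGZK hmod hK hDel98 hPal hmodD W hW hr D hopt hc hδ)

-- `decide` evaluates `discOf`/`c4Of`/`c6Of`, the Kraus tests and the schema point counts on the literal coefficients
set_option maxRecDepth 100000 in
set_option maxHeartbeats 1000000 in
/-- **L₀ = `ord_5 #Ш_an ≤ ord_5 #Ш` for `419850k1`** (Cremona's minimal model `[1, -1, 1, -37505, -2999753]`, `N = 419850 = 5²·16794`; additive potentially GOOD ORDINARY with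
semistability defect `e = 2` at `5` (Kodaira I₀*, cell `N10.CellGordTwo`, `E = V ⊗ χ_{5}` with `V` good ordinary of conductor `16794`); `r_an = 0`, `#Ш_an = 25`, `∏ c_ℓ = 2`, `#E(ℚ)_tors = 1`;
class of 1 curve(s), `5 ∣ #Ш_an` on every member; crux 19357 content row of the A2 R823 residue; NO record of any kind for this row before (lane A: no rank-2 congruent partner in Cremona or in the Hesse-pencil waves)).
IN THE KERNEL: minimality (bounded Kraus form); `Δ ≠ 0`; `ρ̄_{E,5}` onto by Serre Prop. 19 witnesses (i) `q = 13`: `#Ẽ = 8`, `a = 6`, `a² − 4q ≡ 3²`,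
(ii) `q = 7`: `#Ẽ = 9`, `a = -1`, Euler `−1`, (iii) `q = 7`: `#Ẽ = 9`, `a = -1`, `u = 3`; the level `n = 181·211 = 38191 ∈ 𝒩₁(E,5)`:
`#Ẽ(𝔽_{181}) = 180` (kernel), `#Ẽ(𝔽_{211}) = 190` (kernel), both `≡ 0 (mod 5)`, `≢ 0 (mod 5²)`
(cyclic `5`-torsion).
EVIDENCE (value binder `hδ`): `δ̃_{38191} ≡ 4 (mod 5)` — engine 1 = Bf kit j286086 (`D = 2`, rounding deviation `1.3e-09`, exact Hecke relations `390`/0 failed,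
`[0]⁺ = 50` = BSD value); engine 2 (V41 exact twist, SAME level): kit j288123 N0=16794, δ̃_{38191} ≡ 4·c with c = 1 (|c|_5 = 1, exact from [0]), i.e. ≡ 4 (mod 5) — AGREE; V41 values {"38191": "4", "27331": "0"}. Local torsion `E(ℚ_5)[5] = 0` (I₀* twist, `t = 0`: depth-one level is the printed case). Manin: `N > 300000`: `5 ∤ c_D` is the DISPLAYED binder `hc` (Cremona: optimal curve, `c = 1`, DATA).
CONDITIONAL on `hKim` (Kim 2026 Thm. 1.8 (6), PUBLISHED), GZK, modularity, the Manin binder `hc`; per-row instance of crux 19357's conclusion on a `stub_irreducible` row; NOT a class theorem; nothing booked.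
[cite: Kim2022StructureSelmer, Thm. 1.9 (6) (PDF p. 8), §1.2.2, §1.4.3] [cite: Serre1972, §2.8 Prop. 19] [cite: Cremona1997, Table 1 (label 419850k1), §2.8] [cite: Miller2011LMS, Def. 1.1] -/
theorem gordTwoLower_kur_v419850k1_5 (hKim : Kim2026.rankZero_le_padicValNat_sha_of_kuriharaNumber_ne_zero)
    (hGZK : rank_eq_analyticRank_of_analyticRank_le_one) (hmod : hasEntireLFunction_rat)
    (W : WeierstrassCurve ℚ) (hW : W = ⟨1, -1, 1, -37505, -2999753⟩)
    (hr : W.analyticRank = 0) (D : ModularParametrizationData W 419850)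
    (hopt : ∀ z ∈ D.L.lattice, ∃ w ∈ periodLattice D.f, z = D.c * w)
    (hc : ¬ ((5 : ℕ) : ℤ) ∣ D.maninConstant)
    (hδ : ∃ ψ : (ℓ : ℕ) → (ZMod ℓ)ˣ →* Multiplicative (ZMod (5 ^ 1)),
      (∀ ℓ ∈ (181 * 211 : ℕ).primeFactors, Function.Surjective (ψ ℓ)) ∧ kuriharaNumber D.f (5 ^ 1) (181 * 211) ψ ≠ 0) :
    MissingLowerBoundAt W 5 := by
  subst hW
  have hmin : (⟨1, -1, 1, -37505, -2999753⟩ : WeierstrassCurve ℚ).IsGloballyMinimal :=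
    isGloballyMinimal_of_krausCriterion_bounded 1 (-1) 1 (-37505) (-2999753)
      (by decide +kernel) (by decide +kernel) (by decide +kernel)
  haveI := hmin
  haveI : (⟨1, -1, 1, -37505, -2999753⟩ : WeierstrassCurve ℚ).IsElliptic := isElliptic_of_discOf_ne_zero 1 (-1) 1 (-37505) (-2999753) (by decide +kernel)
  have hI : integralModelInt (⟨1, -1, 1, -37505, -2999753⟩ : WeierstrassCurve ℚ) = (⟨1, -1, 1, -37505, -2999753⟩ : WeierstrassCurve ℤ) :=
    integralModelInt_eq_of_map_eq _ (map_mk_int 1 (-1) 1 (-37505) (-2999753))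
  have hsurj : Surj (⟨1, -1, 1, -37505, -2999753⟩ : WeierstrassCurve ℚ) 5 :=
    @surj_of_ainvs_of_serreWitnesses 1 (-1) 1 (-37505) (-2999753) 5 ⟨by norm_num⟩ (by norm_num) hmin
      13 7 7 (by norm_num) (by norm_num) (by norm_num) (by decide) (by decide) (by decide)
      (by decide) (by decide) (by decide) (by decide +kernel) (by decide +kernel) (by decide +kernel)
      (n₁ := 8) (n₂ := 9) (n₃ := 9) (by decide +kernel) (by decide +kernel) (by decide +kernel)
      (3 : ZMod 5) (3 : ZMod 5) (by decide +kernel) (by decide +kernel) (by decide +kernel)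
  -- the `Fact p.Prime` instance enters only now: the `decide` goals above must be closed terms
  haveI hp : Fact (Nat.Prime 5) := ⟨by norm_num⟩
  haveI : Fact (Nat.Prime 181) := ⟨by norm_num⟩
  haveI : Fact (Nat.Prime 211) := ⟨by norm_num⟩
  have hc₁ := natCard_point_eq_of_countPoints 1 (-1) 1 (-37505) (-2999753) 181 (by norm_num) (by decide +kernel) (n := 180) (by decide +kernel)
  have hc₂ := natCard_point_eq_of_countPoints 1 (-1) 1 (-37505) (-2999753) 211 (by norm_num) (by decide +kernel) (n := 190) (by decide +kernel)
  have hk₁ : Kato.IsKolyvaginPrime (⟨1, -1, 1, -37505, -2999753⟩ : WeierstrassCurve ℚ) 5 1 181 :=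
    isKolyvaginPrime_of_intModel_of_card hI 5 1 181 (by norm_num) (by rw [intCurve_Δ]; decide +kernel) (by decide) hc₁ (by norm_num)
  have hk₂ : Kato.IsKolyvaginPrime (⟨1, -1, 1, -37505, -2999753⟩ : WeierstrassCurve ℚ) 5 1 211 :=
    isKolyvaginPrime_of_intModel_of_card hI 5 1 211 (by norm_num) (by rw [intCurve_Δ]; decide +kernel) (by decide) hc₂ (by norm_num)
  haveI : NeZero (181 * 211 : ℕ) := ⟨by norm_num⟩
  obtain ⟨ψ, hψ, hδ⟩ := hδ
  exact X4.missingLowerBoundAt_rankZero_of_kimLower _ 5 hKim hGZK (by norm_num) hsurj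
    (((⟨1, -1, 1, -37505, -2999753⟩ : WeierstrassCurve ℚ).analyticRank_eq_zero_iff_holds (hmod _)).mp hr) D hc (periodTransfer_of_optimal 5 D hopt hc)
    1 (181 * 211) le_rfl (Nat.le_add_left 1 _) (isKolyvaginProduct_mul hk₁ hk₂ (by norm_num))
    (forall_card_torsion_le_of_pair hI 5 181 211 hc₁ hc₂ (by norm_num) (by norm_num)) ψ hψ hδ

/-- **`BSD(E,5)` for `E = 419850k1`** from the Kurihara certificate: LOWER half = `gordTwoLower_kur_v419850k1_5` (Kim 2026 Thm 1.8 (6), this file);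
UPPER half = the cell's semistable-twist door `Addv.missingUpperBoundAt_rankZero_of_semistableTwist_of_surj` (Kato 2004 Thm 17.4 (3) in Wuthrich's
half-eigenspace reading `hK`, Delbourgo 1998 Prop 4 `hDel98`, Pal 2012 `hPal`, modularity `hmod`/`hmodD`; NO Tamagawa / Manin / partner hypothesis) with,
IN THE KERNEL, `Addv W 5` (`5 ∣ Δ`, `5 ∣ c₄`), the twist model `V = [1, -1, 0, -1500, -23698]` (`= E^{(5)}` minimal, conductor `16794`: `Δ ≠ 0`, bounded Kraus form; `#Ṽ(𝔽_5) = 7`, `a_5 = -1`: good ORDINARY at `5`) and the explicit isomorphism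
`⟨1, 1, 1/2, 1/2⟩ • V^{(5)} = W` — i.e. the row lies in cell (G-ord, e = 2) = `N10.CellGordTwo` (crux 19357's domain, stub `stub_irreducible`).
Binders = those of `gordTwoLower_kur_v419850k1_5` + `hK hDel98 hPal hmodD`. Booking-table currency shape of lane A's `bsdp_c<E>_<p>` with the certificate
binder `hδ` (Kurihara VALUE, two engines) in place of `θ` / `hSel`. Per row; NOT a class theorem; nothing booked. BSD is not proved by any of this.
[cite: Kim2022StructureSelmer, Thm. 1.9 (6) (PDF p. 8)] [cite: Kato2004Asterisque, Thm. 17.4 (3) (p. 273)] [cite: Wuthrich2014, §3 (p. 390)] [cite: Delbourgo1998, Prop. 4 (p. 144)]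
[cite: Pal2012, Thm. 3.2] [cite: Miller2011LMS, §1 and Def. 1.1] [cite: Cremona1997, Table 1 (label 419850k1)] -/
theorem gordTwoBsdp_kur_v419850k1_5 (hKim : Kim2026.rankZero_le_padicValNat_sha_of_kuriharaNumber_ne_zero)
    (hGZK : rank_eq_analyticRank_of_analyticRank_le_one) (hmod : hasEntireLFunction_rat)
    (hK : Wuthrich2014.kato_halfEigenCharIdeal_dvd_cyclotomicPrime_of_surjective)
    (hDel98 : Delbourgo1998.prop4_rankZero_pow_dvd_constantCoeff)
    (hPal : Pal2012.thm32_sqrt_mul_realPeriodRat_twist_eq_of_prime_one_mod_four)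
    (hmodD : nonempty_modularParametrizationData)
    (W : WeierstrassCurve ℚ) [W.IsElliptic] [W.IsGloballyMinimal] (hW : W = ⟨1, -1, 1, -37505, -2999753⟩)
    (hr : W.analyticRank = 0) (D : ModularParametrizationData W 419850)
    (hopt : ∀ z ∈ D.L.lattice, ∃ w ∈ periodLattice D.f, z = D.c * w)
    (hc : ¬ ((5 : ℕ) : ℤ) ∣ D.maninConstant)
    (hδ : ∃ ψ : (ℓ : ℕ) → (ZMod ℓ)ˣ →* Multiplicative (ZMod (5 ^ 1)),
      (∀ ℓ ∈ (181 * 211 : ℕ).primeFactors, Function.Surjective (ψ ℓ)) ∧ kuriharaNumber D.f (5 ^ 1) (181 * 211) ψ ≠ 0) :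
    BSDp W 5 := by
  have hlow : MissingLowerBoundAt W 5 :=
    gordTwoLower_kur_v419850k1_5 hKim hGZK hmod W hW hr D hopt hc hδ
  subst hW
  have hminW : (⟨1, -1, 1, -37505, -2999753⟩ : WeierstrassCurve ℚ).IsGloballyMinimal :=
    isGloballyMinimal_of_krausCriterion_bounded 1 (-1) 1 (-37505) (-2999753)
      (by decide +kernel) (by decide +kernel) (by decide +kernel)
  have hIW : integralModelInt (⟨1, -1, 1, -37505, -2999753⟩ : WeierstrassCurve ℚ) = (⟨1, -1, 1, -37505, -2999753⟩ : WeierstrassCurve ℤ) :=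
    integralModelInt_eq_of_map_eq _ (map_mk_int 1 (-1) 1 (-37505) (-2999753))
  have hsurj : Surj (⟨1, -1, 1, -37505, -2999753⟩ : WeierstrassCurve ℚ) 5 :=
    @surj_of_ainvs_of_serreWitnesses 1 (-1) 1 (-37505) (-2999753) 5 ⟨by norm_num⟩ (by norm_num) hminW
      13 7 7 (by norm_num) (by norm_num) (by norm_num) (by decide) (by decide) (by decide)
      (by decide) (by decide) (by decide) (by decide +kernel) (by decide +kernel) (by decide +kernel)
      (n₁ := 8) (n₂ := 9) (n₃ := 9) (by decide +kernel) (by decide +kernel) (by decide +kernel)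
      (3 : ZMod 5) (3 : ZMod 5) (by decide +kernel) (by decide +kernel) (by decide +kernel)
  -- the `Fact p.Prime` instance enters only now: the `decide` goals above must be closed terms
  haveI hp : Fact (Nat.Prime 5) := ⟨by norm_num⟩
  -- the good ordinary twist model V = E^(5) (PARI ellminimalmodel(elltwist(E,5)) = Connell's formulas on (c₄/p², ±c₆/p³)): Δ ≠ 0, Kraus minimality, GoodOrd at p — all kernel
  haveI hVell : (⟨1, -1, 0, -1500, -23698⟩ : WeierstrassCurve ℚ).IsElliptic := isElliptic_of_discOf_ne_zero 1 (-1) 0 (-1500) (-23698) (by decide +kernel)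
  haveI hVmin : (⟨1, -1, 0, -1500, -23698⟩ : WeierstrassCurve ℚ).IsGloballyMinimal :=
    isGloballyMinimal_of_krausCriterion_bounded 1 (-1) 0 (-1500) (-23698)
    (by decide +kernel) (by decide +kernel) (by decide +kernel)
  have hVI : integralModelInt (⟨1, -1, 0, -1500, -23698⟩ : WeierstrassCurve ℚ) = (⟨1, -1, 0, -1500, -23698⟩ : WeierstrassCurve ℤ) :=
    integralModelInt_eq_of_map_eq _ (map_mk_int 1 (-1) 0 (-1500) (-23698))
  have hVc : Nat.card (((⟨1, -1, 0, -1500, -23698⟩ : WeierstrassCurve ℤ).map (Int.castRingHom (ZMod 5))).toAffine.Point) = 7 := by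
    have h := natCard_point_eq_countPoints 1 (-1) 0 (-1500) (-23698) 5 (by norm_num) (by decide +kernel)
    have h' : countPoints [1, -1, 0, -1500, -23698] 5 = 7 := by decide +kernel
    exact_mod_cast h.trans h'
  have hVgood : GoodOrd (⟨1, -1, 0, -1500, -23698⟩ : WeierstrassCurve ℚ) 5 := SecondDescent.goodOrd_of_intModel 5 hVI (by decide +kernel) hVc (by decide)
  have hadd : Addv (⟨1, -1, 1, -37505, -2999753⟩ : WeierstrassCurve ℚ) 5 := Additive.addv_of_intModel hIW 5 (by decide +kernel) (by decide +kernel)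
  have hWV : (⟨1, (1 : ℚ), ((1 : ℚ) / 2), ((1 : ℚ) / 2)⟩ : VariableChange ℚ) • (⟨1, -1, 0, -1500, -23698⟩ : WeierstrassCurve ℚ).quadraticTwist ((-1 : ℚ) ^ (5 / 2) * 5) = (⟨1, -1, 1, -37505, -2999753⟩ : WeierstrassCurve ℚ) := by
    ext <;> simp [WeierstrassCurve.variableChange_a₁, WeierstrassCurve.variableChange_a₂,
      WeierstrassCurve.variableChange_a₃, WeierstrassCurve.variableChange_a₄, WeierstrassCurve.variableChange_a₆,
      WeierstrassCurve.quadraticTwist, WeierstrassCurve.b₂, WeierstrassCurve.b₄, WeierstrassCurve.b₆] <;> norm_num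
  exact bsdp_of_missingPPartAt _ 5 hGZK (by rw [hr]; norm_num)
    (missingPPartAt_of_lower_of_upper _ 5 hlow
      (Addv.missingUpperBoundAt_rankZero_of_semistableTwist_of_surj hK hDel98 hPal hGZK hmod hmodD (by norm_num)
        hadd (⟨1, -1, 0, -1500, -23698⟩ : WeierstrassCurve ℚ) (⟨1, (1 : ℚ), ((1 : ℚ) / 2), ((1 : ℚ) / 2)⟩ : VariableChange ℚ) hWV (Or.inl hVgood) hsurj hr))

/-- **`BSD(E',5)` for every globally minimal `E'` `ℚ`-isogenous to `E = 419850k1`** (Cremona class of 1 curve(s)): Cassels' invariance (`hCassels`,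
`N10.bsdp_of_isIsogenous_of_bsdp`) on `gordTwoBsdp_kur_v419850k1_5`. Per class; nothing booked. [cite: MilneADT2006, Thm. I.7.3 and Remark I.7.4]
[cite: Kim2022StructureSelmer, Thm. 1.9 (6) (PDF p. 8)] [cite: Kato2004Asterisque, Thm. 17.4 (3) (p. 273)] [cite: Miller2011LMS, §1 and Def. 1.1] -/
theorem isogenous_gordTwoBsdp_kur_v419850k1_5 (hCassels : bsdRHS_eq_of_isIsogenous)
    (hKim : Kim2026.rankZero_le_padicValNat_sha_of_kuriharaNumber_ne_zero)
    (hGZK : rank_eq_analyticRank_of_analyticRank_le_one) (hmod : hasEntireLFunction_rat)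
    (hK : Wuthrich2014.kato_halfEigenCharIdeal_dvd_cyclotomicPrime_of_surjective)
    (hDel98 : Delbourgo1998.prop4_rankZero_pow_dvd_constantCoeff)
    (hPal : Pal2012.thm32_sqrt_mul_realPeriodRat_twist_eq_of_prime_one_mod_four)
    (hmodD : nonempty_modularParametrizationData)
    (W : WeierstrassCurve ℚ) [W.IsElliptic] [W.IsGloballyMinimal] (hW : W = ⟨1, -1, 1, -37505, -2999753⟩)
    (hr : W.analyticRank = 0) (D : ModularParametrizationData W 419850)
    (hopt : ∀ z ∈ D.L.lattice, ∃ w ∈ periodLattice D.f, z = D.c * w)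
    (hc : ¬ ((5 : ℕ) : ℤ) ∣ D.maninConstant)
    (hδ : ∃ ψ : (ℓ : ℕ) → (ZMod ℓ)ˣ →* Multiplicative (ZMod (5 ^ 1)),
      (∀ ℓ ∈ (181 * 211 : ℕ).primeFactors, Function.Surjective (ψ ℓ)) ∧ kuriharaNumber D.f (5 ^ 1) (181 * 211) ψ ≠ 0)
    {W' : WeierstrassCurve ℚ} [W'.IsElliptic] [W'.IsGloballyMinimal] (hiso : IsIsogenous W' W) :
    BSDp W' 5 := by
  haveI : Fact (Nat.Prime 5) := ⟨by norm_num⟩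
  have hr' : W'.analyticRank ≤ 1 := by rw [analyticRank_eq_of_isIsogenous' hiso, hr]; exact zero_le_one
  exact N10.bsdp_of_isIsogenous_of_bsdp 5 hCassels hGZK hmod hiso hr'
    (gordTwoBsdp_kur_v419850k1_5 hKim hGZK hmod hK hDel98 hPal hmodD W hW hr D hopt hc hδ)

end Summit.BirchSwinnertonDyer.BirchSwinnertonDyer.Theorems.AdditiveBranchIMCGordTwoRankZeroKurihara

end
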